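import Summits.ValiantsHypothesis.ValiantsHypothesis.Theorems.SymmetroidPencilBasics
import Summits.ValiantsHypothesis.ValiantsHypothesis.Theorems.LacunarySymmetroidMatrixDescartesStubReverse

/-!
PLACEMENT NOTE. A POSITIVE explicit witness (`Z₊(det R₆) ≥ 10`, derivative pencil `det D₆ < 0` on `(0,∞)`); homed under
`Theorems/MatrixDescartes/Negative/` as a calibration AGAINST Rolle-step laws only because the filer is a refuter seat
(val-idea-crit-4, porting val-idea-14's turnkey verbatim; lead R2499 (A)); `MatrixDescartes` is NOT refuted here; a prover may
re-home this file verbatim to the flat name `LacunarySymmetroidMatrixDescartesRolleDefectTen.lean` later.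

# `MatrixDescartes` — negative calibration: the per-step Rolle defect of the derived pencil is `≥ 10` at `n = 2`
# with a ZERO-FREE derived determinant (transfer autopsy, val-idea-14, `Cruxes/MatrixDescartes/LENS-AUTOPSY-transfer-g1.md`)

Crux `stmt-ValiantsHypothesis-18050` (`Theses.LacunarySymmetroid.MatrixDescartes`).  The Laguerre/Rolle proof of Descartes'
rule passes from `f = Σ a_l x^{d_l}` to `(x^{-d_0} f)'` (one term fewer) and pays `≤ 1` root per step.  For symmetric
pencils `F = Σ X^{d_l} S_l` the step `F ↦ F↓ = Σ_{l ≥ 1} (d_l - d_0) X^{d_l - d_0 - 1} S_l` exists, but the price per step is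
not bounded by any function of the size alone: this file certifies the `2 × 2`, `K = 6` instance of the family
`F = [[a + εp, h],[h, b − εq]]` of the autopsy memo (§2(a)) —
`R₆ = J + Σ_{k=1}^{5} X^k P_k`, `J = 10⁶·[[1,−1200],[−1200,1]]`, `P_k = [[1, 10⁶h_k],[10⁶h_k, −1]]`,
`h = (2740, −2250, 850, −150, 10)` (so that `−1200 + Σ h_k x^k = 10(x−1)(x−2)(x−3)(x−4)(x−5)`):
`det R₆` alternates in sign at `1/2 < 1 < 3/2 < ⋯ < 11/2` (so `Z₊(R₆) ≥ 10`, `ten_le_card_posRoots_R₆`), while its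
derived pencil `D₆ = R₆' = Σ k X^{k-1} P_k` has `det D₆(t) = −(p'(t))² − (H'(t))² < 0` for every `t > 0`, hence NO
positive root (`card_posRoots_D₆`).  Rolle defect `Z₊(F) − Z₊(F↓) ≥ 10` at `n = 2` (Cameron–Psarrakos, Oper. Matrices 13
(2019), Ex. 5: defect 4); the memo's family gives `≥ 2K − 2` for every `K`.  Complements `not_DerivedPencilRolle`
(staircase: kills defects `C^K (m+K)^a`); harmless to MDR itself.

[folklore] Elementary; the sign pattern is a `norm_num` certificate at rational points.
-/

set_option linter.dupNamespace false

namespace Summit.ValiantsHypothesis.ValiantsHypothesis.Theorems.LacunarySymmetroidMatrixDescartes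

open Summit.ValiantsHypothesis.ValiantsHypothesis.Theorems.SymmetroidDescartes
  (le_card_posRoots_of_alternating)
open scoped BigOperators Matrix
open Polynomial

namespace RolleDefectWitness

/-- the five coefficients `h₁ … h₅` of `10(x−1)(x−2)(x−3)(x−4)(x−5) + 1200` -/
def hc : Fin 5 → ℝ := ![2740, -2250, 850, -150, 10]

/-- the constant letter `J = 10⁶ · [[1, −1200], [−1200, 1]]` (indefinite) -/
def J₆ : Matrix (Fin 2) (Fin 2) ℝ := !![1000000, -1200000000; -1200000000, 1000000]

/-- the letters `P_k = [[1, 10⁶ h_k], [10⁶ h_k, −1]]` (indefinite, trace zero) at exponents `1 … 5` -/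
def P₆ (k : Fin 5) : Matrix (Fin 2) (Fin 2) ℝ := !![1, 1000000 * hc k; 1000000 * hc k, -1]

/-- the exponents `1, 2, 3, 4, 5` -/
def d₆ : Fin 5 → ℕ := ![1, 2, 3, 4, 5]

/-- the witness pencil `R₆ = X^0 • J + Σ_k X^{d k} • P_k` (`2 × 2`, six terms, exponents `0 … 5`) -/
noncomputable def R₆ : Matrix (Fin 2) (Fin 2) ℝ[X] :=
  ((X : ℝ[X]) ^ (0 : ℕ)) • J₆.map Polynomial.C + ∑ k, ((X : ℝ[X]) ^ d₆ k) • (P₆ k).map Polynomial.C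

/-- the derived letters `k · P_k` -/
def dP₆ (k : Fin 5) : Matrix (Fin 2) (Fin 2) ℝ := ((d₆ k : ℕ) : ℝ) • P₆ k

/-- the derived exponents `0, 1, 2, 3, 4` -/
def dd₆ : Fin 5 → ℕ := ![0, 1, 2, 3, 4]

/-- the derived pencil `D₆ = R₆' = Σ_k k X^{k-1} • P_k` (the constant letter `J` dies), written in the same
`X^e • J + Σ` shape with `J = 0` so that `StubReverse.eval_det_pencil` applies verbatim -/
noncomputable def D₆ : Matrix (Fin 2) (Fin 2) ℝ[X] :=
  ((X : ℝ[X]) ^ (0 : ℕ)) • (0 : Matrix (Fin 2) (Fin 2) ℝ).map Polynomial.C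
    + ∑ k, ((X : ℝ[X]) ^ dd₆ k) • (dP₆ k).map Polynomial.C

/-- the constant letter `J` is symmetric -/
theorem J₆_isSymm : J₆.IsSymm := by
  unfold J₆; ext i j; fin_cases i <;> fin_cases j <;> simp

/-- the letters `P_k` are symmetric -/
theorem P₆_isSymm (k : Fin 5) : (P₆ k).IsSymm := by
  unfold P₆; ext i j; fin_cases i <;> fin_cases j <;> simp

/-- `D₆` is the entrywise derivative of `R₆` -/
theorem derivative_R₆ (i j : Fin 2) : Polynomial.derivative (R₆ i j) = D₆ i j := by
  fin_cases i <;> fin_cases j <;>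
    simp [R₆, D₆, J₆, P₆, dP₆, d₆, dd₆, hc, Fin.sum_univ_five, Matrix.smul_apply,
      Matrix.add_apply, Matrix.map_apply, Polynomial.derivative_pow] <;> ring

/-- `det R₆(t)` in closed form -/
theorem eval_det_R₆ (t : ℝ) :
    (R₆.det).eval t =
      (1000000 + t + t ^ 2 + t ^ 3 + t ^ 4 + t ^ 5) * (1000000 - t - t ^ 2 - t ^ 3 - t ^ 4 - t ^ 5) -
        (1000000 * (-1200 + 2740 * t - 2250 * t ^ 2 + 850 * t ^ 3 - 150 * t ^ 4 + 10 * t ^ 5)) ^ 2 := by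
  unfold R₆
  rw [StubReverse.eval_det_pencil]
  simp [Matrix.det_fin_two, Fin.sum_univ_five, J₆, P₆, d₆, hc]
  ring

/-- `det D₆(t)` in closed form: minus a sum of two squares -/
theorem eval_det_D₆ (t : ℝ) :
    (D₆.det).eval t =
      -((1 + 2 * t + 3 * t ^ 2 + 4 * t ^ 3 + 5 * t ^ 4) ^ 2)
        - (1000000 * (2740 - 4500 * t + 2550 * t ^ 2 - 600 * t ^ 3 + 50 * t ^ 4)) ^ 2 := by
  unfold D₆
  rw [StubReverse.eval_det_pencil]
  simp [Matrix.det_fin_two, Fin.sum_univ_five, dP₆, P₆, d₆, dd₆, hc]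
  ring

/-- eleven positive test points `1/2, 1, …, 11/2` -/
noncomputable def τ₆ : Fin 11 → ℝ := ![1/2, 1, 3/2, 2, 5/2, 3, 7/2, 4, 9/2, 5, 11/2]

/-- the test points increase -/
theorem τ₆_strictMono : StrictMono τ₆ := by
  refine Fin.strictMono_iff_lt_succ.2 fun j => ?_
  fin_cases j <;> simp [τ₆] <;> norm_num

/-- the test points are positive -/
theorem τ₆_pos (j : Fin 11) : 0 < τ₆ j := by
  fin_cases j <;> simp [τ₆]

/-- `det R₆` alternates in sign along the test points (signs `−,+,−,+,−,+,−,+,−,+,−`; `norm_num` certificate) -/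
theorem alt₆ (j : Fin 10) :
    (R₆.det).eval (τ₆ j.castSucc) * (R₆.det).eval (τ₆ j.succ) < 0 := by
  fin_cases j <;> simp only [eval_det_R₆, τ₆] <;> simp <;> norm_num

/-- **`Z₊(R₆) ≥ 10`**. -/
theorem ten_le_card_posRoots_R₆ :
    10 ≤ (R₆.det.roots.toFinset.filter (fun t => 0 < t)).card :=
  le_card_posRoots_of_alternating _ 10 τ₆ τ₆_strictMono τ₆_pos alt₆

/-- `det D₆ < 0` at every positive point (indeed `1 + 2t + ⋯ > 0` there) -/
theorem eval_det_D₆_neg {t : ℝ} (ht : 0 < t) : (D₆.det).eval t < 0 := by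
  rw [eval_det_D₆]
  have h1 : 0 < 1 + 2 * t + 3 * t ^ 2 + 4 * t ^ 3 + 5 * t ^ 4 := by positivity
  nlinarith [sq_nonneg (1000000 * (2740 - 4500 * t + 2550 * t ^ 2 - 600 * t ^ 3 + 50 * t ^ 4)),
    mul_pos h1 h1]

/-- **`Z₊(D₆) = 0`**: the derived pencil has no positive root. -/
theorem card_posRoots_D₆ : (D₆.det.roots.toFinset.filter (fun t => 0 < t)).card = 0 := by
  rw [Finset.card_eq_zero, Finset.filter_eq_empty_iff]
  intro t ht hpos
  rw [Multiset.mem_toFinset, Polynomial.mem_roots'] at ht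
  have h := eval_det_D₆_neg hpos
  have h0 : (D₆.det).eval t = 0 := ht.2
  linarith

/-- **Rolle defect `≥ 10` at `n = 2`.**  The `2 × 2` six-term symmetric pencil `R₆` has at least ten distinct
positive zeros of its determinant while its derivative pencil `D₆ = R₆'` has none. -/
theorem rolleDefect_ten :
    10 ≤ (R₆.det.roots.toFinset.filter (fun t => 0 < t)).card ∧
      (D₆.det.roots.toFinset.filter (fun t => 0 < t)).card = 0 ∧
      (∀ i j, Polynomial.derivative (R₆ i j) = D₆ i j) :=
  ⟨ten_le_card_posRoots_R₆, card_posRoots_D₆, derivative_R₆⟩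

end RolleDefectWitness

end Summit.ValiantsHypothesis.ValiantsHypothesis.Theorems.LacunarySymmetroidMatrixDescartes
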